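import Summits.ValiantsHypothesis.ValiantsHypothesis.Theorems.KPlusLogSqLawTropicalBParallelContact
import Summits.ValiantsHypothesis.ValiantsHypothesis.Theorems.KPlusLogSqLawTropicalBReassemblyDeficit

/-!
# Route «KPlusLogSqLaw», crux `TropicalB` (stmt-ValiantsHypothesis-19771) — NO FREE POLYGON: single-token activation cycles over a common
# state never admit two complementary families of disjoint dockings (free `k`-gon of contacts, any `k`) — the docking corollary of the
# re-assembly deficit

HONEST FRAMING.  Helper toward the registered stubs `stub_tropThin` / `stub_tropFat` of `Cruxes/TropicalB/Lines/birth.lean` (crux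
`Summit.ValiantsHypothesis.ValiantsHypothesis.Theses.KPlusLogSqLaw.TropicalB`, item stmt-ValiantsHypothesis-19771, route KPlusLogSqLaw;
cell `pub-symmetroid`, seat val-sym-trop-p5 g25, refuter-adjacent lane, 2026-08-29; `--supports … --as helper`).  A STRUCTURE law about
unique optima (`IsDominant`) of an ARBITRARY dominance design; nothing here bounds `TropicalB`, and nothing bears on `WeakLifting`,
DoorA26 / DoorA34, `MatrixDescartes` (stmt-ValiantsHypothesis-18050) or VP ≠ VNP.

THE LAW (`FreePolygon.no_free_polygon`).  Let `B` be the unique optimum at `θB` and `P j` (`j : ι`, any nonempty finite index type) unique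
optima at slopes `θ j`, each a SINGLE-TOKEN ACTIVATION over `B` (exponents equal to `B`'s off one column `e j`, larger there).  Write
`ρ_j = σ_B⁻¹ σ_{P j}` (it permutes the deviation set of `P j`: the exchange cycle `Z_j`).  Suppose the deviation of every `P j` is covered by
two disjoint column sets `A j ⊔ A′ j` such that the family `A` is pairwise disjoint and DOCKS (`ρ_j` maps `A j − x j` into `A j − t j` and the
exit onto `t (dock j)`, `dock` a permutation of `ι`) and likewise `A′` with `dock′`, non-degenerately (each `A j` owns a column outside all
`A′ k` where `P j ≠ B`, and vice versa).  THEN THERE IS NO SUCH CONFIGURATION.  With `dock` a `k`-cycle and `dock′` its inverse this is the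
FREE `k`-GON: `k` activation cycles whose consecutive pairwise contacts are pairwise disjoint, the `A j` being the arcs from one contact to
the next and the `A′ j` the complementary arcs (`k = 2`: the parallel double contact of `…TropicalBParallelContact`; `k = 3`: the free
triangle).  Proof: the docking lemma (`Docking.docking`, `…TropicalBDockingLaw`) makes `ω = (P j on A j, B elsewhere)` and
`ω̄ = (P j on A′ j, B elsewhere)` present terms; column by column `f(ω i) + f(ω̄ i) + (k−2)·f(B i) = Σ_j f(P j i)` for every per-cell weight
(`sum_eq_of_two/one/none`), so the valuations satisfy the `k`-gon identity and the slope increments are distributed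
(`J = {j : e j ∈ A j}`, complement for `ω̄`) — contradicting `Deficit.no_two_term_reassembly` (`…TropicalBReassemblyDeficit`).
CONSEQUENCE (memo HOME/val-sym-trop-p5/g25/CONTACT-LAWS-g25.md §1, §3): with the junction hop identity this is the kernel reason why
pairwise-coupled «bit network» architectures (rigid token cells + AND-junctions) need FOREST coupling graphs (trop-p1 g28 located the leaks
on K₃, K₄); for `k = 3` it says the pairwise contacts of three activation cycles over a common state are never pairwise disjoint — a column
common to all three — the skeleton of the located hub of the cell's binary counters (val-sym-trop-p5 g23 §3b).

[folklore ingredients (cycle surgery, lower hulls); the packaging is the cell's, no citation exists]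
-/

set_option linter.dupNamespace false
set_option autoImplicit false

namespace Summit.ValiantsHypothesis.ValiantsHypothesis.Theorems.KPlusLogSqLaw

namespace FreePolygon

open Summit.ValiantsHypothesis.ValiantsHypothesis.Theorems.MatrixDescartes.Negative
open Summit.ValiantsHypothesis.ValiantsHypothesis.Theorems.LacunarySymmetroidMatrixDescartes
open Finset
open scoped BigOperators

variable {m K : ℕ} {ι : Type*} [Fintype ι] [DecidableEq ι]

/-- a sum over a finite type whose terms off two distinct indices equal `c`. [elementary] -/
theorem sum_eq_of_two {g : ι → ℤ} {c : ℤ} (j k : ι) (hjk : j ≠ k) (h : ∀ l, l ≠ j → l ≠ k → g l = c) :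
    ∑ l, g l = g j + g k + ((Fintype.card ι : ℤ) - 2) * c := by
  classical
  have hk : k ∈ univ.erase j := mem_erase.mpr ⟨hjk.symm, mem_univ k⟩
  rw [← add_sum_erase univ g (mem_univ j), ← add_sum_erase _ g hk]
  have hrest : ∑ l ∈ (univ.erase j).erase k, g l = ∑ l ∈ (univ.erase j).erase k, c :=
    sum_congr rfl fun l hl => h l (mem_erase.mp (mem_erase.mp hl).2).1 (mem_erase.mp hl).1
  rw [hrest, sum_const, nsmul_eq_mul, card_erase_of_mem hk, card_erase_of_mem (mem_univ j), card_univ]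
  have h2 : 2 ≤ Fintype.card ι := by
    have : ({j, k} : Finset ι).card ≤ Fintype.card ι := card_le_univ _
    rwa [card_pair hjk] at this
  push_cast [Nat.sub_sub, h2]
  ring

/-- a sum over a finite type whose terms off one index equal `c`. [elementary] -/
theorem sum_eq_of_one {g : ι → ℤ} {c : ℤ} (j : ι) (h : ∀ l, l ≠ j → g l = c) :
    ∑ l, g l = g j + ((Fintype.card ι : ℤ) - 1) * c := by
  classical
  rw [← add_sum_erase univ g (mem_univ j)]
  have hrest : ∑ l ∈ univ.erase j, g l = ∑ l ∈ univ.erase j, c :=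
    sum_congr rfl fun l hl => h l (mem_erase.mp hl).1
  rw [hrest, sum_const, nsmul_eq_mul, card_erase_of_mem (mem_univ j), card_univ]
  have h1 : 1 ≤ Fintype.card ι := Fintype.card_pos_iff.mpr ⟨j⟩
  push_cast [h1]
  ring

omit [DecidableEq ι] in
/-- a constant sum over a finite type. [elementary] -/
theorem sum_eq_of_none {g : ι → ℤ} {c : ℤ} (h : ∀ l, g l = c) : ∑ l, g l = (Fintype.card ι : ℤ) * c := by
  rw [sum_congr rfl fun l _ => h l, sum_const, nsmul_eq_mul, card_univ]

/-- **NO FREE POLYGON.**  Single-token activations `P j` (`j : ι`, any finite index type) over a common base `B` — exponents equal to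
`B`'s off the token column `e j`, larger there — `B` the unique optimum at `θB`, `P j` the unique optimum at `θ j`.  Suppose the
deviation of each `P j` from `B` is covered by two disjoint column sets `A j`, `A′ j` such that BOTH families are pairwise disjoint
dockings in the sense of `Docking.docking` (`ρ_j = σ_B⁻¹σ_{P j}` maps `A j − x j` into `A j − t j` and the exit `x j` onto the terminal
`t (dock j)`, for some permutation `dock` of the indices; likewise `A′, x′, t′, dock′`), non-degenerately (every `A j` has a column in no
`A′ k` where `P j ≠ B`, and vice versa).  Then: contradiction.  For `dock` a `k`-cycle and `dock′` its inverse this is the FREE `k`-GON of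
`k` exchange cycles whose consecutive contacts are pairwise disjoint (`k = 2`: the parallel double contact of `…TropicalBParallelContact`;
`k = 3`: the free triangle).  Proof: the two dockings `ω, ω̄` are present terms with `{ω i, ω̄ i} ∪ {B i}^{k−2… }` re-assembling
`{P j i}` column by column — precisely: `f(ω i) + f(ω̄ i) + (k−2)·f(B i) = Σ_j f(P j i)` for every per-cell weight `f` — so the valuations
satisfy the multiset identity and the slope increments are distributed (`J = {j : e j ∈ A j}`), contradicting
`Deficit.no_two_term_reassembly`.  CONSEQUENCE (memo HOME/val-sym-trop-p5/g25/CONTACT-LAWS-g25.md): among the activation cycles over one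
state there is no free polygon of contacts of any length — with the junction hop identity, the kernel reason why pairwise-coupled «bit
network» architectures need forest coupling graphs. [this cell; folklore ingredients] -/
theorem no_free_polygon [Nonempty ι] (d : Fin K → ℕ) (v ε : Fin m → Fin m → Fin K → ℤ) {θB : ℤ} (θ : ι → ℤ)
    {B : Equiv.Perm (Fin m) × (Fin m → Fin K)} (P : ι → Equiv.Perm (Fin m) × (Fin m → Fin K))
    (hB : IsDominant d v ε θB B) (hP : ∀ j, IsDominant d v ε (θ j) (P j))
    (e : ι → Fin m) (hc : ∀ j i, i ≠ e j → d ((P j).2 i) = d (B.2 i)) (hδ : ∀ j, d (B.2 (e j)) < d ((P j).2 (e j)))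
    (A A' : ι → Finset (Fin m)) (x t x' t' : ι → Fin m) (dock dock' : ι ≃ ι)
    (hAA : ∀ j k, j ≠ k → Disjoint (A j) (A k)) (hA'A' : ∀ j k, j ≠ k → Disjoint (A' j) (A' k))
    (hAA' : ∀ j, Disjoint (A j) (A' j))
    (hcov : ∀ j i, i ∉ A j → i ∉ A' j → (P j).1 i = B.1 i ∧ (P j).2 i = B.2 i)
    (ht : ∀ j, t j ∈ A j) (ht' : ∀ j, t' j ∈ A' j)
    (hin : ∀ j, ∀ i ∈ A j, i ≠ x j → B.1.symm ((P j).1 i) ∈ A j ∧ B.1.symm ((P j).1 i) ≠ t j)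
    (hin' : ∀ j, ∀ i ∈ A' j, i ≠ x' j → B.1.symm ((P j).1 i) ∈ A' j ∧ B.1.symm ((P j).1 i) ≠ t' j)
    (hdock : ∀ j, B.1.symm ((P j).1 (x j)) = t (dock j))
    (hdock' : ∀ j, B.1.symm ((P j).1 (x' j)) = t' (dock' j))
    (hnd : ∀ j, ∃ i ∈ A j, (∀ k, i ∉ A' k) ∧ ¬((P j).1 i = B.1 i ∧ (P j).2 i = B.2 i))
    (hnd' : ∀ j, ∃ i ∈ A' j, (∀ k, i ∉ A k) ∧ ¬((P j).1 i = B.1 i ∧ (P j).2 i = B.2 i)) : False := by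
  classical
  obtain ⟨T₁, h₁in, h₁out⟩ := Docking.docking B P A x t dock hAA ht hin hdock
  obtain ⟨T₂, h₂in, h₂out⟩ := Docking.docking B P A' x' t' dock' hA'A' ht' hin' hdock'
  -- block membership is unique
  have uA : ∀ {i : Fin m} {j k : ι}, i ∈ A j → i ∈ A k → j = k := by
    intro i j k hj hk; by_contra hne; exact disjoint_left.mp (hAA j k hne) hj hk
  have uA' : ∀ {i : Fin m} {j k : ι}, i ∈ A' j → i ∈ A' k → j = k := by
    intro i j k hj hk; by_contra hne; exact disjoint_left.mp (hA'A' j k hne) hj hk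
  -- per-column re-assembly identity, for every per-cell weight `f`
  have col : ∀ (f : Fin m → Fin m → Fin K → ℤ) (i : Fin m),
      f (T₁.1 i) i (T₁.2 i) + f (T₂.1 i) i (T₂.2 i) + ((Fintype.card ι : ℤ) - 2) * f (B.1 i) i (B.2 i) =
        ∑ l, f ((P l).1 i) i ((P l).2 i) := by
    intro f i
    by_cases hiA : ∃ j, i ∈ A j <;> by_cases hiA' : ∃ k, i ∈ A' k
    · obtain ⟨j, hj⟩ := hiA
      obtain ⟨k, hk⟩ := hiA'
      have hjk : j ≠ k := fun h => disjoint_left.mp (hAA' j) hj (h ▸ hk)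
      obtain ⟨a1, a2⟩ := h₁in j i hj
      obtain ⟨b1, b2⟩ := h₂in k i hk
      have hl : ∀ l, l ≠ j → l ≠ k → f ((P l).1 i) i ((P l).2 i) = f (B.1 i) i (B.2 i) := by
        intro l hlj hlk
        obtain ⟨c1, c2⟩ := hcov l i (fun h => hlj (uA h hj)) (fun h => hlk (uA' h hk))
        rw [c1, c2]
      rw [sum_eq_of_two j k hjk hl, a1, a2, b1, b2]
    · obtain ⟨j, hj⟩ := hiA
      have hk : ∀ k, i ∉ A' k := fun k h => hiA' ⟨k, h⟩
      obtain ⟨a1, a2⟩ := h₁in j i hj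
      obtain ⟨b1, b2⟩ := h₂out i hk
      have hl : ∀ l, l ≠ j → f ((P l).1 i) i ((P l).2 i) = f (B.1 i) i (B.2 i) := by
        intro l hlj
        obtain ⟨c1, c2⟩ := hcov l i (fun h => hlj (uA h hj)) (hk l)
        rw [c1, c2]
      rw [sum_eq_of_one j hl, a1, a2, b1, b2]; ring
    · obtain ⟨k, hk⟩ := hiA'
      have hj : ∀ j, i ∉ A j := fun j h => hiA ⟨j, h⟩
      obtain ⟨a1, a2⟩ := h₁out i hj
      obtain ⟨b1, b2⟩ := h₂in k i hk
      have hl : ∀ l, l ≠ k → f ((P l).1 i) i ((P l).2 i) = f (B.1 i) i (B.2 i) := by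
        intro l hlk
        obtain ⟨c1, c2⟩ := hcov l i (hj l) (fun h => hlk (uA' h hk))
        rw [c1, c2]
      rw [sum_eq_of_one k hl, a1, a2, b1, b2]; ring
    · have hj : ∀ j, i ∉ A j := fun j h => hiA ⟨j, h⟩
      have hk : ∀ k, i ∉ A' k := fun k h => hiA' ⟨k, h⟩
      obtain ⟨a1, a2⟩ := h₁out i hj
      obtain ⟨b1, b2⟩ := h₂out i hk
      have hl : ∀ l, f ((P l).1 i) i ((P l).2 i) = f (B.1 i) i (B.2 i) := by
        intro l
        obtain ⟨c1, c2⟩ := hcov l i (hj l) (hk l)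
        rw [c1, c2]
      rw [sum_eq_of_none hl, a1, a2, b1, b2]; ring
  -- presence
  have pres : ∀ i, ε (T₁.1 i) i (T₁.2 i) ≠ 0 ∧ ε (T₂.1 i) i (T₂.2 i) ≠ 0 := by
    intro i
    have hPp : ∀ l, ε ((P l).1 i) i ((P l).2 i) ≠ 0 := fun l => (termSign_ne_zero_iff ε (P l)).1 (hP l).1 i
    have hBp : ε (B.1 i) i (B.2 i) ≠ 0 := (termSign_ne_zero_iff ε B).1 hB.1 i
    constructor
    · by_cases hiA : ∃ j, i ∈ A j
      · obtain ⟨j, hj⟩ := hiA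
        obtain ⟨a1, a2⟩ := h₁in j i hj
        rw [a1, a2]; exact hPp j
      · obtain ⟨a1, a2⟩ := h₁out i (fun j h => hiA ⟨j, h⟩)
        rw [a1, a2]; exact hBp
    · by_cases hiA' : ∃ k, i ∈ A' k
      · obtain ⟨k, hk⟩ := hiA'
        obtain ⟨b1, b2⟩ := h₂in k i hk
        rw [b1, b2]; exact hPp k
      · obtain ⟨b1, b2⟩ := h₂out i (fun k h => hiA' ⟨k, h⟩)
        rw [b1, b2]; exact hBp
  have hT₁ : termSign ε T₁ ≠ 0 := (termSign_ne_zero_iff ε T₁).2 fun i => (pres i).1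
  have hT₂ : termSign ε T₂ ≠ 0 := (termSign_ne_zero_iff ε T₂).2 fun i => (pres i).2
  -- valuation identity
  have hV : (∑ i, v (T₁.1 i) i (T₁.2 i)) + (∑ i, v (T₂.1 i) i (T₂.2 i)) +
      ((Fintype.card ι : ℤ) - 2) * ∑ i, v (B.1 i) i (B.2 i) = ∑ l, ∑ i, v ((P l).1 i) i ((P l).2 i) := by
    rw [sum_comm, mul_sum, ← sum_add_distrib, ← sum_add_distrib]
    exact sum_congr rfl fun i _ => col v i
  -- the token column of `P j` lies in exactly one of `A j`, `A' j`
  have he : ∀ j, e j ∈ A j ∨ e j ∈ A' j := by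
    intro j
    by_contra h
    push Not at h
    have := (hcov j (e j) h.1 h.2).2
    have hlt := hδ j
    rw [this] at hlt
    exact lt_irrefl _ hlt
  have hiff : ∀ j, e j ∈ A' j ↔ ¬ e j ∈ A j := by
    intro j
    constructor
    · exact fun h h' => disjoint_left.mp (hAA' j) h' h
    · intro h; exact (he j).resolve_left h
  -- slopes of the two dockings relative to `B`
  have hδ' : ∀ j, TropicalCensus.slope d (P j) = TropicalCensus.slope d B + (((d ((P j).2 (e j))) : ℤ) - d (B.2 (e j))) :=
    fun j => Docking.slope_eq_of_concentrated d B (P j) (e j) (hc j)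
  have hδpos : ∀ j, TropicalCensus.slope d B < TropicalCensus.slope d (P j) := by
    intro j; rw [hδ' j]; have := hδ j; linarith [show ((d (B.2 (e j)) : ℕ) : ℤ) < d ((P j).2 (e j)) by exact_mod_cast this]
  have slope_of_docking : ∀ (Ab : ι → Finset (Fin m)) (T : Equiv.Perm (Fin m) × (Fin m → Fin K)),
      (∀ {i : Fin m} {j k : ι}, i ∈ Ab j → i ∈ Ab k → j = k) →
      (∀ j, ∀ i ∈ Ab j, T.1 i = (P j).1 i ∧ T.2 i = (P j).2 i) → (∀ i, (∀ j, i ∉ Ab j) → T.1 i = B.1 i ∧ T.2 i = B.2 i) →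
      TropicalCensus.slope d T = TropicalCensus.slope d B
        + ∑ j ∈ univ.filter (fun j => e j ∈ Ab j), (TropicalCensus.slope d (P j) - TropicalCensus.slope d B) := by
    intro Ab T uAb hTin hTout
    have key : ∀ i ∈ (univ : Finset (Fin m)), ((d (T.2 i)) : ℤ) =
        (d (B.2 i) : ℤ) + ∑ l, (if i ∈ Ab l ∧ i = e l then ((d ((P l).2 (e l)) : ℤ) - d (B.2 (e l))) else 0) := by
      intro i _
      by_cases hiA : ∃ j, i ∈ Ab j
      · obtain ⟨j, hj⟩ := hiA
        rw [(hTin j i hj).2]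
        have hl : ∀ l, l ≠ j → (if i ∈ Ab l ∧ i = e l then ((d ((P l).2 (e l)) : ℤ) - d (B.2 (e l))) else 0) = 0 :=
          fun l hlj => if_neg fun h => hlj (uAb h.1 hj)
        rw [sum_eq_of_one j hl, mul_zero, add_zero]
        by_cases hie : i = e j
        · rw [if_pos ⟨hj, hie⟩, hie]; ring
        · rw [if_neg fun h => hie h.2, hc j i hie]; ring
      · have hj : ∀ j, i ∉ Ab j := fun j h => hiA ⟨j, h⟩
        rw [(hTout i hj).2]
        have hl : ∀ l, (if i ∈ Ab l ∧ i = e l then ((d ((P l).2 (e l)) : ℤ) - d (B.2 (e l))) else 0) = 0 :=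
          fun l => if_neg fun h => hj l h.1
        rw [sum_eq_of_none hl]; ring
    unfold TropicalCensus.slope at *
    rw [sum_congr rfl key, sum_add_distrib, sum_comm, sum_filter]
    congr 1
    refine sum_congr rfl fun l _ => ?_
    rw [sum_ite, sum_const_zero, add_zero, sum_const, nsmul_eq_mul]
    by_cases hel : e l ∈ Ab l
    · rw [if_pos hel]
      have : (univ.filter fun i => i ∈ Ab l ∧ i = e l) = {e l} := by
        ext i; simp only [mem_filter, mem_univ, true_and, mem_singleton]
        exact ⟨fun h => h.2, fun h => ⟨h ▸ hel, h⟩⟩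
      rw [this, card_singleton, hδ' l]; push_cast; ring
    · rw [if_neg hel]
      have : (univ.filter fun i => i ∈ Ab l ∧ i = e l) = ∅ := by
        ext i; simp only [mem_filter, mem_univ, true_and, Finset.notMem_empty, iff_false, not_and]
        exact fun h hie => hel (hie ▸ h)
      rw [this, card_empty]; simp
  have slope₁ := slope_of_docking A T₁ uA h₁in h₁out
  have slope₂ := slope_of_docking A' T₂ uA' h₂in h₂out
  -- the two index sets are complementary
  have hJ : univ.filter (fun j => e j ∈ A' j) = (univ.filter fun j => e j ∈ A j)ᶜ := by
    ext j; simp only [mem_filter, mem_univ, true_and, mem_compl, hiff j]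
  rw [hJ] at slope₂
  -- non-degeneracy of the two dockings
  have n₁B : T₁ ≠ B := by
    obtain ⟨j⟩ := ‹Nonempty ι›
    obtain ⟨i, hi, -, hne⟩ := hnd j
    intro h
    obtain ⟨a1, a2⟩ := h₁in j i hi
    exact hne ⟨a1.symm.trans (by rw [h]), a2.symm.trans (by rw [h])⟩
  have n₂B : T₂ ≠ B := by
    obtain ⟨j⟩ := ‹Nonempty ι›
    obtain ⟨i, hi, -, hne⟩ := hnd' j
    intro h
    obtain ⟨b1, b2⟩ := h₂in j i hi
    exact hne ⟨b1.symm.trans (by rw [h]), b2.symm.trans (by rw [h])⟩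
  have n₁P : ∀ j, T₁ ≠ P j := by
    intro j h
    obtain ⟨i, hi, hk, hne⟩ := hnd' j
    obtain ⟨a1, a2⟩ := h₁out i hk
    exact hne ⟨by rw [← a1, h], by rw [← a2, h]⟩
  have n₂P : ∀ j, T₂ ≠ P j := by
    intro j h
    obtain ⟨i, hi, hk, hne⟩ := hnd j
    obtain ⟨b1, b2⟩ := h₂out i hk
    exact hne ⟨by rw [← b1, h], by rw [← b2, h]⟩
  have key := Deficit.no_two_term_reassembly d v ε θ P hB hP hδpos hT₁ hT₂ n₁B n₂B n₁P n₂P _ slope₁ slope₂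
  linarith

end FreePolygon

end Summit.ValiantsHypothesis.ValiantsHypothesis.Theorems.KPlusLogSqLaw
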